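import Summits.BirchSwinnertonDyer.Rank1Residual.Additive.X3BranchGordEndStateThreeOfFacts
import Summits.BirchSwinnertonDyer.Rank1Residual.Additive.X3BranchThreeLineCertificate
import Literature.NumberTheory.EllipticCurves.GreenbergVatsal2000.ResidualLiftingEven
import HarnessLib

/-!
# X3 on the semistable-twist locus, cell (G-ord, `e = 2`) at `p = 3`: `MissingLowerBoundAt W 3` and
# `BSD(E,3)` from PUBLISHED named facts ONLY — the displayed lifting of
# `X3BranchGordEndStateThreeOfFacts.lean` discharged by the reading-fact
# `residualEpsilon_surjOn_of_lineEven` (GV 2000 p. 28 with the proof on p. 30) (cell `bsd-addord`,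
# seat `bsd-addord-twist`, strategy = twist transport)

HONEST FRAMING (cell `bsd-addord`, `run/shared/lean/pub/bsd-addord/README.md` §4): the programme's
target of record is the full Birch–Swinnerton-Dyer formula for every `E/ℚ` of analytic rank `≤ 1`;
this file concerns the NON-DEGENERATE X3 rows of cell (G-ord, `e = 2`) at `p = 3`, `r_an = 0`, non-CM,
non-anomalous, on the branch-parity line position. THEOREMS ONLY (no `def`, no named fact, no
`sorry`). Every hypothesis that is not a class/line binder is a PUBLISHED named fact of the tree
(`hW16`, `hGV`, `h23`, `h414`, `hGrK`, `hLiftE`, `hDel3`, `hDel98`, `hGZK`, `hmod`, `hmodD`). The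
per-pair line datum `Φ₀` (rational, EVEN, non-trivial `Γ_ℚ`-action, `χ_{−3}`-twist ramified at `3`)
stays displayed; the last two theorems take instead the PER-PAIR CERTIFICATE `(x₀, D, s, q)` of
`X3BranchThreeLineCertificate.exists_lineDatum_three_of_cert` (a rational root `x₀` of `Ψ₃`, the
squarefree part `D > 0` of `Ψ₂Sq(x₀)` with an odd prime factor `q` and `3 ∤ D`). Nothing is booked by
this file (planner's / referee's call).

References: [GreenbergVatsal2000] §2 (11), (16), pp. 28–30, §3 Thm. (3.12) p. 45; [Wuthrich2014]
Thm. 16; [GreenbergLNM1716] Props. 2.2, 2.4, 4.14; [Delbourgo2002] Thm. (A), (B); [Delbourgo1998]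
Prop. 4; [Miller2011LMS] Def. 1.1.
-/

set_option autoImplicit false

noncomputable section

open scoped Classical MatrixGroups ModularForm

namespace Summit.BirchSwinnertonDyer.Rank1Residual.Additive

open CongruenceSubgroup WeierstrassCurve NumberField IsDedekindDomain Field
  Literature.NumberTheory.EllipticCurves
  Literature.NumberTheory.EllipticCurves.ModularForms
  Literature.NumberTheory.EllipticCurves.GreenbergVatsal2000
  Literature.NumberTheory.EllipticCurves.Rank1Residual
  Literature.NumberTheory.EllipticCurves.Rank1Residual.Typed
  Literature.NumberTheory.GaloisRepresentations
  Summit.BirchSwinnertonDyer.Rank1Residual.X1.MuLambda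
  Summit.BirchSwinnertonDyer.Rank1Residual.AdditivePotMult
  Summit.BirchSwinnertonDyer.Rank1Residual.Additive.X3Branch

variable {W : WeierstrassCurve ℚ} [W.IsElliptic] [W.IsGloballyMinimal]

/-- **X3♯(G-ord) at `3`, `r_an = 0`, non-CM, OFF the anomalous and degenerate rows, on the
branch-parity line position: `Typed.MissingLowerBoundAt W 3` FROM PUBLISHED FACTS ONLY** + the per-pair
line datum `Φ₀` (rational, even, non-trivial `Γ_ℚ`-action, `χ_{−3}`-twist ramified). The lifting is the
reading-fact `hLiftE` (GV p. 28 with p. 30, even line). [cite: Delbourgo2002, Theorem (A), (B) (p. 40)]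
[cite: GreenbergVatsal2000, §2 (11), (16), pp. 28–30, §3 Thm. (3.12) p. 45] [cite: Wuthrich2014, Thm. 16 (p. 397)]
[cite: GreenbergLNM1716, Props. 2.2, 2.4, 4.14] [cite: Miller2011LMS, Def. 1.1] -/
theorem ClassX3Gord.missingLowerBoundAt_three_rankZero_of_facts_of_nonAnomalous
    [hp : Fact (Nat.Prime 3)]
    (hW16 : Wuthrich2014.thm16_halfEigenCharIdeal_dvd_cyclotomicPrime)
    (hGV : thm312_branch_unitContent_and_lambda_eq_residual_goodOrd)
    (h23 : datumSelmer_nonPrimitive_invariants)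
    (h414 : Greenberg1999.prop414_noFiniteSubmodule_of_not_dvd_torsionOrder)
    (hGrK : Greenberg1999.imKummer_ge_strictCondition_goodOrdinary)
    (hLiftE : residualEpsilon_surjOn_of_lineEven)
    (hDel3 : Delbourgo2002.mainTheorem_three)
    (hGZK : rank_eq_analyticRank_of_analyticRank_le_one) (hmod : hasEntireLFunction_rat)
    (hmodD : nonempty_modularParametrizationData)
    (hX : ClassX3Gord W 3) (hcm : ¬ W.HasCM) (hr : W.analyticRank = 0)
    (hna : Delbourgo2002.ReductionNonAnomalous W 3)
    (Φ₀ : AddSubgroup (W.geomTorsion ((3 : ℕ) : ℤ))) (hΦ : IsRationalLine W 3 Φ₀)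
    (heven : LineEven W 3 Φ₀)
    (hnt : ∃ (σ : absoluteGaloisGroup ℚ) (P : W.geomTorsion ((3 : ℕ) : ℤ)), P ∈ Φ₀ ∧ σ • P ≠ P)
    (hram : ∀ (K : Type) [Field K] [NumberField K] [(galRange (K := ℚ) K).Normal],
      Module.finrank ℚ K = 2 →
      (∃ θ : K, θ ^ 2 = algebraMap ℚ K ((-1) ^ ((3 : ℕ) / 2) * (3 : ℕ))) →
      ¬ ∀ v : HeightOneSpectrum (𝓞 ℚ), (((3 : ℕ) : ℕ) : 𝓞 ℚ) ∈ v.asIdeal →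
        ∀ 𝔓 ∈ v.primesAbove, ∀ σ ∈ 𝔓.inertia (absoluteGaloisGroup ℚ), ∀ P ∈ Φ₀,
          σ • P = (if σ ∈ galRange (K := ℚ) K then P else -P)) :
    MissingLowerBoundAt W 3 :=
  ClassX3Gord.missingLowerBoundAt_three_rankZero_of_facts_of_lifting_of_nonAnomalous hW16 hGV h23 h414
    hGrK hDel3 hGZK hmod hmodD hX hcm hr hna Φ₀ hΦ heven hnt hram
    (fun κ S₀ hκ hS₀ hS ↦ hLiftE W 3 κ S₀ Φ₀ hΦ (by norm_num) hκ heven hS₀ hS)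

/-- **X3♯(G-ord) at `3`, `r_an = 0`, non-CM, OFF the anomalous and degenerate rows, on the
branch-parity line position: Miller's `BSD(E,3)` FROM PUBLISHED FACTS ONLY** + the per-pair line datum.
[cite: Delbourgo2002, Theorem (A), (B) (p. 40)] [cite: Delbourgo1998, Prop. 4 (p. 144)]
[cite: Wuthrich2014, Thm. 16 (p. 397)] [cite: GreenbergVatsal2000, §2 (11), (16), pp. 28–30, §3 Thm. (3.12) p. 45]
[cite: Miller2011LMS, §1 and Def. 1.1] -/
theorem ClassX3Gord.bsdp_three_rankZero_of_facts_of_nonAnomalous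
    [hp : Fact (Nat.Prime 3)]
    (hW16 : Wuthrich2014.thm16_halfEigenCharIdeal_dvd_cyclotomicPrime)
    (hGV : thm312_branch_unitContent_and_lambda_eq_residual_goodOrd)
    (h23 : datumSelmer_nonPrimitive_invariants)
    (h414 : Greenberg1999.prop414_noFiniteSubmodule_of_not_dvd_torsionOrder)
    (hGrK : Greenberg1999.imKummer_ge_strictCondition_goodOrdinary)
    (hLiftE : residualEpsilon_surjOn_of_lineEven)
    (hDel3 : Delbourgo2002.mainTheorem_three)
    (hDel98 : Delbourgo1998.prop4_rankZero_pow_dvd_constantCoeff)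
    (hGZK : rank_eq_analyticRank_of_analyticRank_le_one) (hmod : hasEntireLFunction_rat)
    (hmodD : nonempty_modularParametrizationData)
    (hX : ClassX3Gord W 3) (hcm : ¬ W.HasCM) (hr : W.analyticRank = 0)
    (hna : Delbourgo2002.ReductionNonAnomalous W 3)
    (Φ₀ : AddSubgroup (W.geomTorsion ((3 : ℕ) : ℤ))) (hΦ : IsRationalLine W 3 Φ₀)
    (heven : LineEven W 3 Φ₀)
    (hnt : ∃ (σ : absoluteGaloisGroup ℚ) (P : W.geomTorsion ((3 : ℕ) : ℤ)), P ∈ Φ₀ ∧ σ • P ≠ P)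
    (hram : ∀ (K : Type) [Field K] [NumberField K] [(galRange (K := ℚ) K).Normal],
      Module.finrank ℚ K = 2 →
      (∃ θ : K, θ ^ 2 = algebraMap ℚ K ((-1) ^ ((3 : ℕ) / 2) * (3 : ℕ))) →
      ¬ ∀ v : HeightOneSpectrum (𝓞 ℚ), (((3 : ℕ) : ℕ) : 𝓞 ℚ) ∈ v.asIdeal →
        ∀ 𝔓 ∈ v.primesAbove, ∀ σ ∈ 𝔓.inertia (absoluteGaloisGroup ℚ), ∀ P ∈ Φ₀,
          σ • P = (if σ ∈ galRange (K := ℚ) K then P else -P)) :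
    BSDp W 3 :=
  ClassX3Gord.bsdp_three_rankZero_of_facts_of_lifting_of_nonAnomalous hW16 hGV h23 h414 hGrK hDel3 hDel98
    hGZK hmod hmodD hX hcm hr hna Φ₀ hΦ heven hnt hram
    (fun κ S₀ hκ hS₀ hS ↦ hLiftE W 3 κ S₀ Φ₀ hΦ (by norm_num) hκ heven hS₀ hS)

/-- **X3♯(G-ord) at `3`, `r_an = 0`, non-CM, non-anomalous: `Typed.MissingLowerBoundAt W 3` FROM
PUBLISHED FACTS + a PER-PAIR CERTIFICATE `(x₀, D, s, q)`** (`Ψ₃(x₀) = 0`, `D` squarefree, `s ≠ 0`,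
`D·s² = Ψ₂Sq(x₀)`, `0 < D`, odd prime `q ∣ D`, `3 ∤ D` — `exists_lineDatum_three_of_cert`).
[cite: Delbourgo2002, Theorem (A), (B) (p. 40)] [cite: GreenbergVatsal2000, §2 (11), (16), pp. 28–30, §3 Thm. (3.12) p. 45]
[cite: Wuthrich2014, Thm. 16 (p. 397)] [cite: Miller2011LMS, Def. 1.1] -/
theorem ClassX3Gord.missingLowerBoundAt_three_rankZero_of_facts_of_cert_of_nonAnomalous
    [hp : Fact (Nat.Prime 3)]
    (hW16 : Wuthrich2014.thm16_halfEigenCharIdeal_dvd_cyclotomicPrime)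
    (hGV : thm312_branch_unitContent_and_lambda_eq_residual_goodOrd)
    (h23 : datumSelmer_nonPrimitive_invariants)
    (h414 : Greenberg1999.prop414_noFiniteSubmodule_of_not_dvd_torsionOrder)
    (hGrK : Greenberg1999.imKummer_ge_strictCondition_goodOrdinary)
    (hLiftE : residualEpsilon_surjOn_of_lineEven)
    (hDel3 : Delbourgo2002.mainTheorem_three)
    (hGZK : rank_eq_analyticRank_of_analyticRank_le_one) (hmod : hasEntireLFunction_rat)
    (hmodD : nonempty_modularParametrizationData)
    (hX : ClassX3Gord W 3) (hcm : ¬ W.HasCM) (hr : W.analyticRank = 0)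
    (hna : Delbourgo2002.ReductionNonAnomalous W 3)
    {x₀ s : ℚ} {D : ℤ} (hψ : W.Ψ₃.eval x₀ = 0) (hsq : Squarefree D) (hs : s ≠ 0)
    (hDs : (D : ℚ) * s ^ 2 = W.Ψ₂Sq.eval x₀) (hpos : 0 < D)
    (q : ℕ) [Fact q.Prime] (hq2 : q ≠ 2) (hqD : (q : ℤ) ∣ D) (h3D : ¬ (3 : ℤ) ∣ D) :
    MissingLowerBoundAt W 3 := by
  obtain ⟨Φ₀, hΦ, heven, hnt, hram⟩ := exists_lineDatum_three_of_cert hψ hsq hs hDs hpos q hq2 hqD h3D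
  exact ClassX3Gord.missingLowerBoundAt_three_rankZero_of_facts_of_nonAnomalous hW16 hGV h23 h414 hGrK
    hLiftE hDel3 hGZK hmod hmodD hX hcm hr hna Φ₀ hΦ heven hnt hram

/-- **X3♯(G-ord) at `3`, `r_an = 0`, non-CM, non-anomalous: Miller's `BSD(E,3)` FROM PUBLISHED FACTS
+ a PER-PAIR CERTIFICATE `(x₀, D, s, q)`** (`exists_lineDatum_three_of_cert`).
[cite: Delbourgo2002, Theorem (A), (B) (p. 40)] [cite: Delbourgo1998, Prop. 4 (p. 144)]
[cite: Wuthrich2014, Thm. 16 (p. 397)] [cite: GreenbergVatsal2000, §2 (11), (16), pp. 28–30]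
[cite: Miller2011LMS, §1 and Def. 1.1] -/
theorem ClassX3Gord.bsdp_three_rankZero_of_facts_of_cert_of_nonAnomalous
    [hp : Fact (Nat.Prime 3)]
    (hW16 : Wuthrich2014.thm16_halfEigenCharIdeal_dvd_cyclotomicPrime)
    (hGV : thm312_branch_unitContent_and_lambda_eq_residual_goodOrd)
    (h23 : datumSelmer_nonPrimitive_invariants)
    (h414 : Greenberg1999.prop414_noFiniteSubmodule_of_not_dvd_torsionOrder)
    (hGrK : Greenberg1999.imKummer_ge_strictCondition_goodOrdinary)
    (hLiftE : residualEpsilon_surjOn_of_lineEven)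
    (hDel3 : Delbourgo2002.mainTheorem_three)
    (hDel98 : Delbourgo1998.prop4_rankZero_pow_dvd_constantCoeff)
    (hGZK : rank_eq_analyticRank_of_analyticRank_le_one) (hmod : hasEntireLFunction_rat)
    (hmodD : nonempty_modularParametrizationData)
    (hX : ClassX3Gord W 3) (hcm : ¬ W.HasCM) (hr : W.analyticRank = 0)
    (hna : Delbourgo2002.ReductionNonAnomalous W 3)
    {x₀ s : ℚ} {D : ℤ} (hψ : W.Ψ₃.eval x₀ = 0) (hsq : Squarefree D) (hs : s ≠ 0)
    (hDs : (D : ℚ) * s ^ 2 = W.Ψ₂Sq.eval x₀) (hpos : 0 < D)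
    (q : ℕ) [Fact q.Prime] (hq2 : q ≠ 2) (hqD : (q : ℤ) ∣ D) (h3D : ¬ (3 : ℤ) ∣ D) :
    BSDp W 3 := by
  obtain ⟨Φ₀, hΦ, heven, hnt, hram⟩ := exists_lineDatum_three_of_cert hψ hsq hs hDs hpos q hq2 hqD h3D
  exact ClassX3Gord.bsdp_three_rankZero_of_facts_of_nonAnomalous hW16 hGV h23 h414 hGrK hLiftE hDel3
    hDel98 hGZK hmod hmodD hX hcm hr hna Φ₀ hΦ heven hnt hram

end Summit.BirchSwinnertonDyer.Rank1Residual.Additive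

end
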